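import Summits.QuantumFields.YangMills.Theorems.FluctuationComparisonRegPrIntLS2BetaChartReadGaugeCovariance
import HarnessLib

/-!
# S2β · (REG-UP)′ bridge (O2-c) — «GAUGE COVARIANCE OF THE k-STEP CHART-READ AND OF ITS LINEARISATION»: the k-step editions of ✓`…ChartReadGaugeCovariance`'s doors (β)∕(β′):
# `↑(Ψ_k^{h•U₀}(Ad_h A)(c)) = h_k(c₋)·↑(Ψ_k^{U₀}(A)(c))·h_k(c₋)⋆` and `↑((DΨ_k^{h•U₀}(0)(Ad_h X))(c)) = h_k(c₋)·↑((DΨ_k^{U₀}(0) X)(c))·h_k(c₋)⋆`, `h_k = transfUp h k`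
# (the second structural input of `hDcov` on the Prop-4 road, after (O2-a) ✓`…ChartReadIterTranslate`)

Cell `ym3-torus` (YM ladder rung R3 = continuum `SU(2)` Yang–Mills on the three-torus at fixed lattice data — a RUNG: NOT d = 4, NOT infinite volume, NOT a mass gap,
NOT Clay).  Width seat «width 12» `ym3-torus-px12` (gen 27); crux `stmt-QuantumFields-20520`, LINE g18-1 S2β, node (REG-UP)′ (px13 g29's K-uniform road, binder `hDcov`).
`--kind proof --supports stmt-QuantumFields-20520 --as helper`, count-neutral, DEFINITION-FREE (0 `def`, 0 `instance`, 0 `notation`, 0 `sorry`, default heartbeats).  Generic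
`P : Params`, `SU(N)`, `k ≤ m + K`; conventions of ✓p823800∕✓`…ChartReadDescentChainRule`∕✓`…ChartReadGaugeCovariance` VERBATIM (`Θ`∕`Λ`, `Ū^k = Averaging.iter (blockAvg expMeanLogSU) k`,
`Ψ_k^{V} A c := Λ(Ū^k(Θ(A)·V)(c)·Ū^k(V)(c)⁻¹)`, `(Ad_h X)_b := ⟨h(b₋)·↑X_b·h(b₋)⋆, conj_mem_lie⟩`, `(h•U₀)(b) = h(b₋)U₀(b)h(b₊)⁻¹`, `h_k := transfUp h k` (lit ✓`T4Continuum.transfUp`)).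

WHAT IS PROVED (sorry-free).
* §1 ★`iter_piExpChart_gaugeAct` (`Ū^k(Θ(Ad_h A)·(h•U₀)) = h_k•Ū^k(Θ(A)·U₀)`, ✓`piExpChart_translate_gaugeAct` ∘ lit ✓`iter_gaugeAct`), ★`relAvg_iter_gaugeAct` (the k-step relative average
  is conjugated by `h_k(c₋)`), ★`smallBelow_gaugeAct` (the (0.4) guard below `k` is gauge invariant, ✓`dist1_loopHol_gaugeAct`).
* §2 ★★`coe_chartRead_iter_gaugeAct` — **door (β)_k**: on the log window at `c`, `↑(Ψ_k^{h•U₀}(Ad_h A)(c)) = ↑(h_k c₋)·↑(Ψ_k^{U₀}(A)(c))·(↑(h_k c₋))⋆` (✓`coe_logChart_conj`).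
* §3 ★★★**`coe_fderiv_chartRead_iter_gaugeAct`** — **door (β′)_k**: under `SmallBelow … k U₀`, `↑((fderiv ℝ Ψ_k^{h•U₀} 0 (Ad_h X)) c) = ↑(h_k c₋)·↑((fderiv ℝ Ψ_k^{U₀} 0 X) c)·(↑(h_k c₋))⋆`
  (ray derivatives ✓`hasDerivAt_chartRead_iter_ray` at `U₀` and at `h•U₀` (§1 guard), the window near `t = 0` by ✓`eventually_norm_rel_iter_lt`, §2 along the ray, `Ad_h(tX) = t·Ad_h X`
  ✓`conj_smul`, uniqueness of derivatives); norms are then equal by ✓`norm_coe_conj_le` twice.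
USE ((REG-UP)′ `hDcov`, px13 g29 98552164): with (O2-a) `(DΨ^{U₀}X₀)(c + v̄) = (DΨ^{τU₀}(τX₀))(c)` and THIS FILE at `h := g` (the straight transport, `g•τ_aU₀ =: U₀′`):
`(DΨ^{τU₀}(τX₀))(c) = Ad_{g_k(c₋)⁻¹}((DΨ^{U₀′}(Ad_g τX₀))(c))`; then (O2-b) background-Lipschitz `U₀′ ↦ U₀` and (O2-d) the thin-rectangle closeness of `U₀′` to `U₀`.

HONEST SCOPE.  Group∕chart bookkeeping and kernel calculus over landed engines (✓`…ChartReadGaugeCovariance`, ✓`…ChartReadDescentChainRule`∕`…DescentOnto`, lit ✓`iter_gaugeAct`); nothing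
of Bałaban's renormalisation-group analysis is asserted or proved ([Balaban1985Averaging] (11)–(13) p.19, Prop. 3 (121)–(122) p.36 are the SOURCES of the objects); (O2-b), (O2-d),
`hDcov`, (REG-UP)′, GAP♯∘ (`stub_uniformFibreGapOrbit`, registry 3732b7df UNTOUCHED, 0∕5), the five registered stubs, S2β, crux 20520, 19936, 19200, `YM3TorusSU2` — NOT proved; no
registered stub is closed; rung R3 — NOT d = 4, NOT infinite volume, NOT a mass gap, NOT Clay; the Yang–Mills mass gap is NOT proved.
-/

set_option autoImplicit false

noncomputable section

open scoped Matrix.Norms.L2Operator Topology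
open Filter Set Function Metric

namespace Summit.QuantumFields.YangMills.Theorems.FluctuationComparisonRegPrIntLS2BetaChartReadIterGaugeCovariance

open Literature.MathematicalPhysics.QuantumFieldTheory.Balaban1983to89
open Literature.MathematicalPhysics.QuantumFieldTheory.Balaban1983to89.HaarExponentialChart
open Literature.MathematicalPhysics.QuantumFieldTheory.Balaban1983to89.HaarExponentialChart.IsChartRep
open Literature.MathematicalPhysics.QuantumFieldTheory.Balaban1983to89.BlockAveraging (Small Idx avgFun loopHol blockAvg blockAvg_avg loopHol_gaugeAct)
open Literature.MathematicalPhysics.QuantumFieldTheory.Balaban1983to89.ExpMeanLog (expMeanLogSU deltaSU deltaSU_pos)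
open Literature.MathematicalPhysics.QuantumFieldTheory.Balaban1983to89.Node00
open Literature.MathematicalPhysics.QuantumFieldTheory.Balaban1983to89.T4Continuum (transfUp iter_gaugeAct)
open Summit.QuantumFields.YangMills.BalabanUVNodes.N09ChartReadAveragingSmooth
open Summit.QuantumFields.YangMills.Theorems.FluctuationComparisonRegPrIntLS2BetaChartReadGaugeCovariance
  (conj_mem_lie conj_smul piExpChart_translate_gaugeAct coe_logChart_conj dist1_loopHol_gaugeAct)
open Summit.QuantumFields.YangMills.Theorems.FluctuationComparisonRegPrIntLS2BetaChartReadDescentOnto (eventually_norm_rel_iter_lt)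
open Summit.QuantumFields.YangMills.Theorems.FluctuationComparisonRegPrIntLS2BetaChartReadDescentChainRule (hasDerivAt_chartRead_iter_ray)

variable {P : Params} {N : ℕ} [NeZero N]
variable (h : GaugeTransf P 0 (SU N)) (U₀ : GaugeField P 0 (SU N))

/-! ## §1 The k-step relative average is conjugated; the guard is gauge invariant -/

/-- ★ `Ū^k(Θ(Ad_h A)·(h•U₀)) = h_k•Ū^k(Θ(A)·U₀)` (`k ≤ m + K`). [cite: Balaban1985Averaging, (11) p.19; Balaban1987RG1, (0.6) p.253] -/
theorem iter_piExpChart_gaugeAct {k : ℕ} (hk : k ≤ P.m + P.K) (A : PBond P 0 → (specialUnitaryLogChart (Fin N)).lie) :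
    Averaging.iter (fun i => blockAvg (P := P) (j := i) (expMeanLogSU (n := Fin N))) k
        (fun b : PBond P 0 => (isChartRep_specialUnitaryGroup (n := Fin N)).expChart ((fun b : PBond P 0 => (⟨((h b.src : SU N) : Matrix (Fin N) (Fin N) ℂ) * ((A b : (specialUnitaryLogChart (Fin N)).lie) : Matrix (Fin N) (Fin N) ℂ) * star ((h b.src : SU N) : Matrix (Fin N) (Fin N) ℂ), conj_mem_lie (h b.src) (A b)⟩ : (specialUnitaryLogChart (Fin N)).lie)) b) * (GaugeField.gaugeAct h U₀) b) =
      GaugeField.gaugeAct (transfUp h k)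
        (Averaging.iter (fun i => blockAvg (P := P) (j := i) (expMeanLogSU (n := Fin N))) k
          (fun b : PBond P 0 => (isChartRep_specialUnitaryGroup (n := Fin N)).expChart (A b) * U₀ b)) := by
  rw [piExpChart_translate_gaugeAct h U₀ A]
  exact iter_gaugeAct _ h k hk _

/-- ★ **THE k-STEP RELATIVE AVERAGE IS CONJUGATED BY `h_k(c₋)`** (§1 twice; the `h_k(c₊)` factors cancel). [cite: Balaban1985Averaging, (11) p.19; Balaban1987RG1, (0.6) p.253] -/
theorem relAvg_iter_gaugeAct {k : ℕ} (hk : k ≤ P.m + P.K) (A : PBond P 0 → (specialUnitaryLogChart (Fin N)).lie) (c : PBond P k) :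
    Averaging.iter (fun i => blockAvg (P := P) (j := i) (expMeanLogSU (n := Fin N))) k
        (fun b : PBond P 0 => (isChartRep_specialUnitaryGroup (n := Fin N)).expChart ((fun b : PBond P 0 => (⟨((h b.src : SU N) : Matrix (Fin N) (Fin N) ℂ) * ((A b : (specialUnitaryLogChart (Fin N)).lie) : Matrix (Fin N) (Fin N) ℂ) * star ((h b.src : SU N) : Matrix (Fin N) (Fin N) ℂ), conj_mem_lie (h b.src) (A b)⟩ : (specialUnitaryLogChart (Fin N)).lie)) b) * (GaugeField.gaugeAct h U₀) b) c *
        (Averaging.iter (fun i => blockAvg (P := P) (j := i) (expMeanLogSU (n := Fin N))) k (GaugeField.gaugeAct h U₀) c)⁻¹ =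
      transfUp h k c.src *
        (Averaging.iter (fun i => blockAvg (P := P) (j := i) (expMeanLogSU (n := Fin N))) k
            (fun b : PBond P 0 => (isChartRep_specialUnitaryGroup (n := Fin N)).expChart (A b) * U₀ b) c *
          (Averaging.iter (fun i => blockAvg (P := P) (j := i) (expMeanLogSU (n := Fin N))) k U₀ c)⁻¹) * (transfUp h k c.src)⁻¹ := by
  rw [iter_piExpChart_gaugeAct h U₀ hk A, iter_gaugeAct _ h k hk U₀]
  show transfUp h k c.src * _ * (transfUp h k c.tgt)⁻¹ * (transfUp h k c.src * _ * (transfUp h k c.tgt)⁻¹)⁻¹ = _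
  group

/-- ★ **THE (0.4) GUARD BELOW `k` IS GAUGE INVARIANT** (`k ≤ m + K`; loops are conjugated, `dist1` is conjugation invariant). [cite: Balaban1987RG1, (0.4) p.253; Balaban1985Averaging, (12)-(13) p.19] -/
theorem smallBelow_gaugeAct {k : ℕ} (hk : k ≤ P.m + P.K)
    (hsb : SmallBelow (fun i => blockAvg (P := P) (j := i) (expMeanLogSU (n := Fin N))) k U₀) :
    SmallBelow (fun i => blockAvg (P := P) (j := i) (expMeanLogSU (n := Fin N))) k (GaugeField.gaugeAct h U₀) := by
  intro j hj c i
  rw [iter_gaugeAct _ h j (by omega) U₀, dist1_loopHol_gaugeAct]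
  exact hsb j hj c i

/-! ## §2 Door (β)_k: the k-step chart read is gauge covariant -/

/-- ★★ **DOOR (β)_k**: on the log window at `c`, `↑(Ψ_k^{h•U₀}(Ad_h A)(c)) = ↑(h_k c₋)·↑(Ψ_k^{U₀}(A)(c))·(↑(h_k c₋))⋆`. [cite: Balaban1985Averaging, (11)-(13) p.19, Prop. 3 (121) p.36; Balaban1987RG1, (0.6), (0.11) p.253] -/
theorem coe_chartRead_iter_gaugeAct {k : ℕ} (hk : k ≤ P.m + P.K) (A : PBond P 0 → (specialUnitaryLogChart (Fin N)).lie) (c : PBond P k)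
    (hwin : ‖((Averaging.iter (fun i => blockAvg (P := P) (j := i) (expMeanLogSU (n := Fin N))) k
            (fun b : PBond P 0 => (isChartRep_specialUnitaryGroup (n := Fin N)).expChart (A b) * U₀ b) c *
          (Averaging.iter (fun i => blockAvg (P := P) (j := i) (expMeanLogSU (n := Fin N))) k U₀ c)⁻¹ : SU N) : Matrix (Fin N) (Fin N) ℂ) - 1‖ <
        innerRadius (specialUnitaryLogChart (Fin N))) :
    (((isChartRep_specialUnitaryGroup (n := Fin N)).logChart
        (Averaging.iter (fun i => blockAvg (P := P) (j := i) (expMeanLogSU (n := Fin N))) k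
            (fun b : PBond P 0 => (isChartRep_specialUnitaryGroup (n := Fin N)).expChart ((fun b : PBond P 0 => (⟨((h b.src : SU N) : Matrix (Fin N) (Fin N) ℂ) * ((A b : (specialUnitaryLogChart (Fin N)).lie) : Matrix (Fin N) (Fin N) ℂ) * star ((h b.src : SU N) : Matrix (Fin N) (Fin N) ℂ), conj_mem_lie (h b.src) (A b)⟩ : (specialUnitaryLogChart (Fin N)).lie)) b) * (GaugeField.gaugeAct h U₀) b) c *
          (Averaging.iter (fun i => blockAvg (P := P) (j := i) (expMeanLogSU (n := Fin N))) k (GaugeField.gaugeAct h U₀) c)⁻¹) : (specialUnitaryLogChart (Fin N)).lie) : Matrix (Fin N) (Fin N) ℂ) =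
      ((transfUp h k c.src : SU N) : Matrix (Fin N) (Fin N) ℂ) *
        ((((isChartRep_specialUnitaryGroup (n := Fin N)).logChart
          (Averaging.iter (fun i => blockAvg (P := P) (j := i) (expMeanLogSU (n := Fin N))) k
              (fun b : PBond P 0 => (isChartRep_specialUnitaryGroup (n := Fin N)).expChart (A b) * U₀ b) c *
            (Averaging.iter (fun i => blockAvg (P := P) (j := i) (expMeanLogSU (n := Fin N))) k U₀ c)⁻¹)) : (specialUnitaryLogChart (Fin N)).lie) : Matrix (Fin N) (Fin N) ℂ) *
        star ((transfUp h k c.src : SU N) : Matrix (Fin N) (Fin N) ℂ) := by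
  rw [relAvg_iter_gaugeAct h U₀ hk A c]
  exact coe_logChart_conj (transfUp h k c.src) _ hwin

/-! ## §3 Door (β′)_k: the k-step linearised chart map is gauge covariant -/

/-- ★★★ **DOOR (β′)_k — THE k-STEP CHART-READ DERIVATIVE IS GAUGE COVARIANT**: under the (0.4) guard below `k` for `U₀` (`k ≤ m + K`),
`↑((fderiv ℝ Ψ_k^{h•U₀} 0 (Ad_h X)) c) = ↑(h_k c₋)·↑((fderiv ℝ Ψ_k^{U₀} 0 X) c)·(↑(h_k c₋))⋆`. [cite: Balaban1985Averaging, (11)-(13) p.19, Prop. 3 (122) p.36, Prop. 4 (127) p.37; Balaban1987RG1, (0.11) p.253] -/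
theorem coe_fderiv_chartRead_iter_gaugeAct {k : ℕ} (hk : k ≤ P.m + P.K)
    (hsb : SmallBelow (fun i => blockAvg (P := P) (j := i) (expMeanLogSU (n := Fin N))) k U₀)
    (X : PBond P 0 → (specialUnitaryLogChart (Fin N)).lie) (c : PBond P k) :
    ((fderiv ℝ (fun (A : PBond P 0 → (specialUnitaryLogChart (Fin N)).lie) (c : PBond P k) =>
          (isChartRep_specialUnitaryGroup (n := Fin N)).logChart
            (Averaging.iter (fun i => blockAvg (P := P) (j := i) (expMeanLogSU (n := Fin N))) k
                (fun b => (isChartRep_specialUnitaryGroup (n := Fin N)).expChart (A b) * (GaugeField.gaugeAct h U₀) b) c *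
              (Averaging.iter (fun i => blockAvg (P := P) (j := i) (expMeanLogSU (n := Fin N))) k (GaugeField.gaugeAct h U₀) c)⁻¹)) 0
        (fun b : PBond P 0 => (⟨((h b.src : SU N) : Matrix (Fin N) (Fin N) ℂ) * ((X b : (specialUnitaryLogChart (Fin N)).lie) : Matrix (Fin N) (Fin N) ℂ) * star ((h b.src : SU N) : Matrix (Fin N) (Fin N) ℂ), conj_mem_lie (h b.src) (X b)⟩ : (specialUnitaryLogChart (Fin N)).lie)) c :
          (specialUnitaryLogChart (Fin N)).lie) : Matrix (Fin N) (Fin N) ℂ) =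
      ((transfUp h k c.src : SU N) : Matrix (Fin N) (Fin N) ℂ) *
        ((fderiv ℝ (fun (A : PBond P 0 → (specialUnitaryLogChart (Fin N)).lie) (c : PBond P k) =>
            (isChartRep_specialUnitaryGroup (n := Fin N)).logChart
              (Averaging.iter (fun i => blockAvg (P := P) (j := i) (expMeanLogSU (n := Fin N))) k
                  (fun b => (isChartRep_specialUnitaryGroup (n := Fin N)).expChart (A b) * U₀ b) c *
                (Averaging.iter (fun i => blockAvg (P := P) (j := i) (expMeanLogSU (n := Fin N))) k U₀ c)⁻¹)) 0 X c :
          (specialUnitaryLogChart (Fin N)).lie) : Matrix (Fin N) (Fin N) ℂ) *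
        star ((transfUp h k c.src : SU N) : Matrix (Fin N) (Fin N) ℂ) := by
  set Ψ₀ := fun (A : PBond P 0 → (specialUnitaryLogChart (Fin N)).lie) (c : PBond P k) =>
      (isChartRep_specialUnitaryGroup (n := Fin N)).logChart
        (Averaging.iter (fun i => blockAvg (P := P) (j := i) (expMeanLogSU (n := Fin N))) k
            (fun b => (isChartRep_specialUnitaryGroup (n := Fin N)).expChart (A b) * U₀ b) c *
          (Averaging.iter (fun i => blockAvg (P := P) (j := i) (expMeanLogSU (n := Fin N))) k U₀ c)⁻¹) with hΨ₀
  set Ψ₁ := fun (A : PBond P 0 → (specialUnitaryLogChart (Fin N)).lie) (c : PBond P k) =>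
      (isChartRep_specialUnitaryGroup (n := Fin N)).logChart
        (Averaging.iter (fun i => blockAvg (P := P) (j := i) (expMeanLogSU (n := Fin N))) k
            (fun b => (isChartRep_specialUnitaryGroup (n := Fin N)).expChart (A b) * (GaugeField.gaugeAct h U₀) b) c *
          (Averaging.iter (fun i => blockAvg (P := P) (j := i) (expMeanLogSU (n := Fin N))) k (GaugeField.gaugeAct h U₀) c)⁻¹) with hΨ₁
  set Xh : PBond P 0 → (specialUnitaryLogChart (Fin N)).lie := fun b : PBond P 0 =>
      (⟨((h b.src : SU N) : Matrix (Fin N) (Fin N) ℂ) * ((X b : (specialUnitaryLogChart (Fin N)).lie) : Matrix (Fin N) (Fin N) ℂ) * star ((h b.src : SU N) : Matrix (Fin N) (Fin N) ℂ), conj_mem_lie (h b.src) (X b)⟩ : (specialUnitaryLogChart (Fin N)).lie) with hXh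
  set H : Matrix (Fin N) (Fin N) ℂ := ((transfUp h k c.src : SU N) : Matrix (Fin N) (Fin N) ℂ) with hH
  -- the two ray derivatives, read at `c` and coerced to matrices
  set L : (specialUnitaryLogChart (Fin N)).lie →L[ℝ] Matrix (Fin N) (Fin N) ℂ := ((specialUnitaryLogChart (Fin N)).lie).subtypeL with hL
  have hray₀ := (hasDerivAt_pi.1 (hasDerivAt_chartRead_iter_ray (P := P) (N := N) U₀ k hsb X)) c
  have hray₁ := (hasDerivAt_pi.1 (hasDerivAt_chartRead_iter_ray (P := P) (N := N) (GaugeField.gaugeAct h U₀) k (smallBelow_gaugeAct h U₀ hk hsb) Xh)) c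
  have hc₀ : HasDerivAt (fun t : ℝ => ((Ψ₀ (t • X) c : (specialUnitaryLogChart (Fin N)).lie) : Matrix (Fin N) (Fin N) ℂ))
      (((fderiv ℝ Ψ₀ 0 X) c : (specialUnitaryLogChart (Fin N)).lie) : Matrix (Fin N) (Fin N) ℂ) 0 :=
    L.hasFDerivAt.comp_hasDerivAt (0 : ℝ) hray₀
  have hc₁ : HasDerivAt (fun t : ℝ => ((Ψ₁ (t • Xh) c : (specialUnitaryLogChart (Fin N)).lie) : Matrix (Fin N) (Fin N) ℂ))
      (((fderiv ℝ Ψ₁ 0 Xh) c : (specialUnitaryLogChart (Fin N)).lie) : Matrix (Fin N) (Fin N) ℂ) 0 :=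
    L.hasFDerivAt.comp_hasDerivAt (0 : ℝ) hray₁
  have hg : HasDerivAt (fun t : ℝ => H * ((Ψ₀ (t • X) c : (specialUnitaryLogChart (Fin N)).lie) : Matrix (Fin N) (Fin N) ℂ) * star H)
      (H * (((fderiv ℝ Ψ₀ 0 X) c : (specialUnitaryLogChart (Fin N)).lie) : Matrix (Fin N) (Fin N) ℂ) * star H) 0 :=
    (hc₀.const_mul H).mul_const (star H)
  -- `Ad_h (t•X) = t • Ad_h X`
  have hsm : ∀ t : ℝ, t • Xh = fun b : PBond P 0 =>
      (⟨((h b.src : SU N) : Matrix (Fin N) (Fin N) ℂ) * (((t • X) b : (specialUnitaryLogChart (Fin N)).lie) : Matrix (Fin N) (Fin N) ℂ) * star ((h b.src : SU N) : Matrix (Fin N) (Fin N) ℂ), conj_mem_lie (h b.src) ((t • X) b)⟩ : (specialUnitaryLogChart (Fin N)).lie) := by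
    intro t; funext b
    rw [Pi.smul_apply, hXh, Pi.smul_apply]
    exact (conj_smul (h b.src) t (X b)).symm
  -- the window near `t = 0` (along the ray) and the covariance of the chart read there
  have htend : Tendsto (fun t : ℝ => t • X) (𝓝 0) (𝓝 0) := by
    have hcont : Continuous (fun t : ℝ => t • X) := continuous_id.smul continuous_const
    simpa using hcont.tendsto 0
  have heq : (fun t : ℝ => ((Ψ₁ (t • Xh) c : (specialUnitaryLogChart (Fin N)).lie) : Matrix (Fin N) (Fin N) ℂ)) =ᶠ[𝓝 0]
      fun t : ℝ => H * ((Ψ₀ (t • X) c : (specialUnitaryLogChart (Fin N)).lie) : Matrix (Fin N) (Fin N) ℂ) * star H := by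
    filter_upwards [htend (eventually_norm_rel_iter_lt (P := P) (N := N) U₀ k hsb)] with t ht
    rw [hsm t]
    exact coe_chartRead_iter_gaugeAct h U₀ hk (t • X) c (ht c)
  exact hc₁.unique (hg.congr_of_eventuallyEq heq)

end Summit.QuantumFields.YangMills.Theorems.FluctuationComparisonRegPrIntLS2BetaChartReadIterGaugeCovariance

end
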